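/-
Copyright (c) 2026 the pub-hodgecm-mathlib formalisation cell (harness21).  Prover seat hodgecm-mathlib-K2Liu-p12 (g5), Track B «K2-LIT»,
#184♮ = hLiu418 = `stmt-HodgeConjecture-24832`; #41 middle term, cut (u-0c) I3 EDITION 2 `K2LiuSiegelMiddleTermKTypesLevel` (LEAD F0P6-plan (g14) BATCH #82 (1) ∕ #92 (1);
bytes = I4 desk K2E4-p11 (g8) 22:33:35Z + addendum 22:35:48Z; consumer = I4 ED. 5 «PREIMAGE LEVEL»).  THEOREMS ONLY (no `def`, no `instance`, no notation,
no named-fact hypothesis, no `sorry`).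
-/
import Summits.HodgeConjecture.HodgeConjecture.Theorems.K2LiuSiegelMiddleTermKTypes     -- ★ I3 ED. 1: `borel_compact_law_of_flat`, `re_half_lt_re_of_dist_le`, `exists_bound_of_continuousOn_halfBall` (+ ★ `exists_flat_extension`, `ofFinite_mem`)
import Mathlib.Topology.Algebra.OpenSubgroup
import HarnessLib

/-!
# Crux `HLiu418`, #41 middle term, (u-0c) I3 ED. 2: THE `K`-TYPES OF THE UNTWISTED INNER FAMILY AT A PREIMAGE LEVEL — ★ I3 `exists_KTypes_package` re-run for an OPEN
# FINITE-INDEX subgroup `KG ≤ K = K_∞·GL₂(𝒪̂_L)` with `Λ(KG) ⊆ K_H` (road of record M-158j (R-a), desk K2E5-p17 (g9) 22:29:42Z)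

Cell `hodgecm-mathlib`, crux item hLiu418 = `stmt-HodgeConjecture-24832` (helper lane `--supports`, count-neutral).  ★ I3 `exists_KTypes_package` produced the `W`-package +
`hφW`, `hφbd` of the untwisted inner family `φ s x g = a g · b x · F s (Λ g · k_x)` under the tie `hΛK : Λ(K) ⊆ K_H`, which is generic-false for the socket's arbitrary STANDARD
datum (its finite level `C_f` is an arbitrary open compact).  THIS EDITION replaces that tie by the PREIMAGE LEVEL: an OPEN subgroup `KG` of FINITE INDEX in `K` with
`Λ(KG) ⊆ K_H` (at the tie: `KG := Λ⁻¹(𝒦.K) ⊓ K`), and the single `K_H`-type expansion of `F` by ONE EXPANSION PER TRANSLATE `F(Λ k · h)`, `k ∈ K` (★ p862178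
`exists_KHType_of_standard` at `a := (↑· * Λ k)`, paid by I4 ED. 5); the level letters are `ha_lev` (★ DetCharacter), the `U`-level of the coefficients with `Λ(level) ⊆ U`
(★ p862505∕p862552 `exists_level_letters_of_blk`), `hlevKG : level ⊆ KG` and `hlevN` (the `K`-conjugates of the level stay in the level, ★ `K2LiuGL2LevelConjugate.exists_level_conj`).
OUTPUT = ★ I3's `∃ W (_ : FiniteDimensional ℂ W), hWstab ∧ hWlaw ∧ hWlev ∧ hWcont ∧ hWext ∧ hφW ∧ hφbd` BYTE-IDENTICAL.

THE CONSTRUCTION [MoeglinWaldspurger1995, I.2.17, II.1.7, IV.1.9], [Bump1997, §3.7], [BorelJacquet1979, §1.1, §4.1].  Left cosets `K = ⊔_q rep(q)·KG` (`q ∈ K ⧸ KG`, finitely many);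
generators `g_{q,l}(k) := 𝟙[k ∈ rep(q)KG] · a k · c^{(q)}_l(Λ(rep(q)⁻¹k))` (the `K_H`-type `c^{(q)}, M^{(q)}, G^{(q)}` of the translate `F(Λ rep(q) · h)`); `W₀ := span{g_{q,l}}` contains
every `φ(s,x)|_K` (on the coset of `k`, `F s (Λ k · k_x) = F s (Λ rep(q) · (Λ(rep(q)⁻¹k)·k_x))`, then the law at `k₁ := k_x`) and is right-`KG`-stable (`rep(q)⁻¹ k t`, law at `k₁ := Λ t ∈ K_H`);
**`W₁ := ⨆_q R_{rep(q)} W₀`** is finite-dimensional and right-`K`-stable (`R_{k₀} R_{rep q} = R_{k₀·rep q} = R_{rep q'} R_t`, `t ∈ KG` — NO normal core needed); `W := W₁ ⊓ Wlaw`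
(the `B ∩ K`-law subspace, as ★ I3).  `hWcont`: the cosets are clopen (`KG` open ⇒ closed, Mathlib `Subgroup.isClosed_of_isOpen`; `Continuous.if`); `hWlev`: on `W₀` by `hlevKG`
(`r̂ ∈ KG` keeps the coset), `ha_lev`, and the `U`-level of `c` (`Λ r̂ ∈ U`); on `R_{rep q} W₀` by `hlevN` (`r̂ · rep q = rep q · r̂′`); `hWext` ★ `exists_flat_extension`;
`hφbd` on the half-ball from the bounds of `c^{(q)}` on `K_H` and of `G^{(q)}` (★ `exists_bound_of_continuousOn_halfBall`), uniformly over the finitely many `q`.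
References: [MoeglinWaldspurger1995, I.2.17, II.1.7, IV.1.9]; [Bump1997, §3.7]; [CogdellAnalyticTheory2004, §2.3]; [BorelJacquet1979, §1.1, §4.1].
HONEST LABEL: HC_CM is proved only modulo the 7 printed citations (2 remaining named inputs: hLiu418 = stmt-HodgeConjecture-24832,
h413 = stmt-HodgeConjecture-24833) until rung 0 closes; count-neutral helper, closes no socket.
-/

set_option autoImplicit false
set_option linter.dupNamespace false

noncomputable section

open NumberField IsDedekindDomain Set Filter Topology Metric
open scoped NNReal Matrix Classical
open Literature.NumberTheory.Automorphic
open Summit.HodgeConjecture.HodgeConjecture.Cruxes.HLiu418.K2LiuGL2FlatSectionFiniteData (ofFinite_mem)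
open Summit.HodgeConjecture.HodgeConjecture.Cruxes.HLiu418.K2LiuGL2FlatExtension (exists_flat_extension)
open Summit.HodgeConjecture.HodgeConjecture.Cruxes.HLiu418.K2LiuSiegelMiddleTermKTypes (borel_compact_law_of_flat re_half_lt_re_of_dist_le
  exists_bound_of_continuousOn_halfBall)

namespace Summit.HodgeConjecture.HodgeConjecture.Cruxes.HLiu418.K2LiuSiegelMiddleTermKTypesLevel

variable {L : Type} [Field L] [NumberField L]

/-- **(u-0c) I3, EDITION 2 — THE `K`-TYPES OF THE UNTWISTED INNER FAMILY AT A PREIMAGE LEVEL.**  For `φ s x g = a g · b x · F s (Λ g · k_x)` (`Λ : GL₂(𝔸_L) →* H` a continuous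
homomorphism, `k_x ∈ K_H`) with the flat torus law and unipotent invariance; an OPEN FINITE-INDEX subgroup `KG` of `K = K_∞·GL₂(𝒪̂_L)` with `Λ(KG) ⊆ K_H`; for every `k ∈ K` a finite
`K_H`-type of the translate `h ↦ F s (Λ k · h)` (coefficients `c_j` continuous on `H`, bounded on `K_H`, with the matrix-coefficient law, scalar families `G_j` continuous on `{0 < re}`,
and `U`-level); `a` continuous, multiplicative and bounded on `K` and invariant under the `GL₂`-level `(S, γl)`; `Λ(level) ⊆ U`, `level ⊆ KG`, and the `K`-conjugates of the level
in the level; `‖b x‖ ≤ C₀·height x ^ A₀`: there is a finite-dimensional right-`K`-stable `W ≤ (K → ℂ)` with the `B ∩ K`-law, the level, continuous members and flat extensions,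
containing every `φ(s,x)|_K` (`0 < re s`), with `‖φ s x k‖ ≤ C · height x ^ A` locally uniformly in `s` — ★ I3 `exists_KTypes_package`'s OUTPUT VERBATIM.
[cite: MoeglinWaldspurger1995, II.1.7, IV.1.9] [cite: Bump1997, §3.7] [cite: BorelJacquet1979, §1.1, §4.1] [cite: CogdellAnalyticTheory2004, §2.3] -/
theorem exists_KTypes_package_level
    (S : Finset (HeightOneSpectrum (𝓞 L))) (γl : ∀ v : HeightOneSpectrum (𝓞 L), ValuativeRel.ValueGroupWithZero (v.adicCompletion L))
    {X : Type*} (height : X → ℝ) (hpos : ∀ x, 0 < height x)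
    {H : Type*} [Group H] [TopologicalSpace H] [ContinuousMul H] (KH : Subgroup H)
    (F : ℂ → H → ℂ) (a : GL (Fin 2) (AdeleRing (𝓞 L) L) → ℂ) (b : X → ℂ) (Λ : GL (Fin 2) (AdeleRing (𝓞 L) L) →* H) (hΛc : Continuous Λ) (kx : X → H)
    (φ : ℂ → X → GL (Fin 2) (AdeleRing (𝓞 L) L) → ℂ) (hφ : ∀ s x g, φ s x g = a g * b x * F s (Λ g * kx x))
    (hφT : ∀ (s : ℂ) (x : X), 0 < s.re → ∀ (d : Fin 2 → (AdeleRing (𝓞 L) L)ˣ) (g : GL (Fin 2) (AdeleRing (𝓞 L) L)),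
      φ s x (glDiagonal 2 (AdeleRing (𝓞 L) L) d * g) =
      ((IdeleClassGroup.ideleNorm L (d 0) : ℝ) : ℂ) ^ (s + 1 / 2) * ((IdeleClassGroup.ideleNorm L (d 1) : ℝ) : ℂ) ^ (-(s + 1 / 2)) * φ s x g)
    (hφN : ∀ (s : ℂ) (x : X), 0 < s.re → ∀ u g : GL (Fin 2) (AdeleRing (𝓞 L) L), (u : Matrix (Fin 2) (Fin 2) (AdeleRing (𝓞 L) L)) 1 0 = 0 →
      (u : Matrix (Fin 2) (Fin 2) (AdeleRing (𝓞 L) L)) 0 0 = 1 → (u : Matrix (Fin 2) (Fin 2) (AdeleRing (𝓞 L) L)) 1 1 = 1 → φ s x (u * g) = φ s x g)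
    -- the preimage level: an OPEN, FINITE-INDEX subgroup of `K` mapped into `K_H` by `Λ`
    (KG : Subgroup (GL (Fin 2) (AdeleRing (𝓞 L) L)))
    (hKGo : IsOpen ((KG.subgroupOf (standardMaximalCompactGL 2 L) : Subgroup ↥(standardMaximalCompactGL 2 L)) : Set ↥(standardMaximalCompactGL 2 L)))
    (hKGfi : (KG.subgroupOf (standardMaximalCompactGL 2 L)).FiniteIndex)
    (hΛK : ∀ k ∈ KG, Λ k ∈ KH) (hkx : ∀ x, kx x ∈ KH)
    -- one finite `K_H`-type per translate `F(Λ k · h)`, with `U`-level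
    (U : Subgroup H)
    (hKH : ∀ k : ↥(standardMaximalCompactGL 2 L), ∃ (ι : Type) (_ : Fintype ι) (c : ι → H → ℂ) (M : ι → ι → H → ℂ) (G : ι → ℂ → ℂ),
      (∀ j h k₁, k₁ ∈ KH → c j (h * k₁) = ∑ l, M j l k₁ * c l h) ∧ (∀ s, 0 < s.re → ∀ h ∈ KH, F s (Λ k * h) = ∑ j, c j h * G j s) ∧
      (∀ j, ContinuousOn (G j) {s | 0 < s.re}) ∧ (∀ j, Continuous (c j)) ∧ (∃ Cc, ∀ j, ∀ h ∈ KH, ‖c j h‖ ≤ Cc) ∧ (∃ CM, ∀ j l, ∀ k₁ ∈ KH, ‖M j l k₁‖ ≤ CM) ∧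
      (∀ j h, ∀ u ∈ U, c j (h * u) = c j h))
    (ha_cont : Continuous fun k : ↥(standardMaximalCompactGL 2 L) => a k)
    (ha_mul : ∀ k k₀ : ↥(standardMaximalCompactGL 2 L), a ((k * k₀ : ↥(standardMaximalCompactGL 2 L)) : GL (Fin 2) (AdeleRing (𝓞 L) L)) = a k * a k₀)
    {Ca C₀ A₀ : ℝ} (hCa : ∀ k : ↥(standardMaximalCompactGL 2 L), ‖a k‖ ≤ Ca) (hA₀ : 0 ≤ A₀) (hb : ∀ x, ‖b x‖ ≤ C₀ * height x ^ A₀)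
    -- the `GL₂`-level `(S, γl)`: `a`-invariance, `Λ(level) ⊆ U`, `level ⊆ KG`, `K`-conjugates of the level in the level
    (ha_lev : ∀ (k : ↥(standardMaximalCompactGL 2 L)) (r : GL (Fin 2) (FiniteAdeleRing (𝓞 L) L)), r ∈ glFiniteIntegralLevel 2 L →
      (∀ v ∈ S, GLn.evalAt 2 L v r ∈ congruenceGL 2 (γl v)) → a ((k : GL (Fin 2) (AdeleRing (𝓞 L) L)) * GLn.ofFinite 2 L r) = a k)
    (hΛU : ∀ r : GL (Fin 2) (FiniteAdeleRing (𝓞 L) L), r ∈ glFiniteIntegralLevel 2 L → (∀ v ∈ S, GLn.evalAt 2 L v r ∈ congruenceGL 2 (γl v)) →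
      Λ (GLn.ofFinite 2 L r) ∈ U)
    (hlevKG : ∀ r : GL (Fin 2) (FiniteAdeleRing (𝓞 L) L), r ∈ glFiniteIntegralLevel 2 L → (∀ v ∈ S, GLn.evalAt 2 L v r ∈ congruenceGL 2 (γl v)) →
      GLn.ofFinite 2 L r ∈ KG)
    (hlevN : ∀ r : GL (Fin 2) (FiniteAdeleRing (𝓞 L) L), r ∈ glFiniteIntegralLevel 2 L → (∀ v ∈ S, GLn.evalAt 2 L v r ∈ congruenceGL 2 (γl v)) →
      ∀ k : ↥(standardMaximalCompactGL 2 L), ∃ r' : GL (Fin 2) (FiniteAdeleRing (𝓞 L) L), r' ∈ glFiniteIntegralLevel 2 L ∧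
        (∀ v ∈ S, GLn.evalAt 2 L v r' ∈ congruenceGL 2 (γl v)) ∧
        ((k : GL (Fin 2) (AdeleRing (𝓞 L) L)))⁻¹ * GLn.ofFinite 2 L r * k = GLn.ofFinite 2 L r') :
    ∃ (W : Submodule ℂ (↥(standardMaximalCompactGL 2 L) → ℂ)) (_ : FiniteDimensional ℂ W),
      (∀ B ∈ W, ∀ k₀ : ↥(standardMaximalCompactGL 2 L), (fun k => B (k * k₀)) ∈ W) ∧
      (∀ B ∈ W, ∀ p k : ↥(standardMaximalCompactGL 2 L),
        ((p : GL (Fin 2) (AdeleRing (𝓞 L) L)) : Matrix (Fin 2) (Fin 2) (AdeleRing (𝓞 L) L)) 1 0 = 0 → B (p * k) = B k) ∧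
      (∀ B ∈ W, ∀ (k : ↥(standardMaximalCompactGL 2 L)) (r : GL (Fin 2) (FiniteAdeleRing (𝓞 L) L)) (hr : r ∈ glFiniteIntegralLevel 2 L),
        (∀ v ∈ S, GLn.evalAt 2 L v r ∈ congruenceGL 2 (γl v)) →
        B ⟨(k : GL (Fin 2) (AdeleRing (𝓞 L) L)) * GLn.ofFinite 2 L r, (standardMaximalCompactGL 2 L).mul_mem k.2 (ofFinite_mem hr)⟩ = B k) ∧
      (∀ B ∈ W, Continuous B) ∧
      (∀ B ∈ W, ∃ bB : ℂ → GL (Fin 2) (AdeleRing (𝓞 L) L) → ℂ,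
        (∀ s : ℂ, 0 < s.re → ∀ (d : Fin 2 → (AdeleRing (𝓞 L) L)ˣ) (g : GL (Fin 2) (AdeleRing (𝓞 L) L)),
        bB s (glDiagonal 2 (AdeleRing (𝓞 L) L) d * g) =
        ((IdeleClassGroup.ideleNorm L (d 0) : ℝ) : ℂ) ^ (s + 1 / 2) * ((IdeleClassGroup.ideleNorm L (d 1) : ℝ) : ℂ) ^ (-(s + 1 / 2)) * bB s g) ∧
        (∀ s : ℂ, 0 < s.re → ∀ u g : GL (Fin 2) (AdeleRing (𝓞 L) L), (u : Matrix (Fin 2) (Fin 2) (AdeleRing (𝓞 L) L)) 1 0 = 0 →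
        (u : Matrix (Fin 2) (Fin 2) (AdeleRing (𝓞 L) L)) 0 0 = 1 → (u : Matrix (Fin 2) (Fin 2) (AdeleRing (𝓞 L) L)) 1 1 = 1 → bB s (u * g) = bB s g) ∧
        (∀ s : ℂ, 0 < s.re → ∀ (k : GL (Fin 2) (AdeleRing (𝓞 L) L)) (hk : k ∈ standardMaximalCompactGL 2 L), bB s k = B ⟨k, hk⟩)) ∧
      (∀ (s : ℂ) (x : X), 0 < s.re → (fun k : ↥(standardMaximalCompactGL 2 L) => φ s x k) ∈ W) ∧
      (∀ z : ℂ, 0 < z.re → ∃ C A r : ℝ, 0 ≤ C ∧ 0 ≤ A ∧ 0 < r ∧ ∀ s : ℂ, dist s z < r →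
        ∀ (x : X) (k : ↥(standardMaximalCompactGL 2 L)), ‖φ s x k‖ ≤ C * height x ^ A) := by
  -- §0 cosets of the preimage level: `K = ⊔_q rep(q)·KG'`, finitely many, clopen
  set KG' : Subgroup ↥(standardMaximalCompactGL 2 L) := KG.subgroupOf (standardMaximalCompactGL 2 L) with hKG'
  haveI : KG'.FiniteIndex := hKGfi
  haveI : Fintype (↥(standardMaximalCompactGL 2 L) ⧸ KG') := Subgroup.fintypeQuotientOfFiniteIndex
  have hmemKG' : ∀ t : ↥(standardMaximalCompactGL 2 L), t ∈ KG' ↔ (t : GL (Fin 2) (AdeleRing (𝓞 L) L)) ∈ KG := fun t => Subgroup.mem_subgroupOf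
  obtain ⟨rep, hrep⟩ : ∃ rep : ↥(standardMaximalCompactGL 2 L) ⧸ KG' → ↥(standardMaximalCompactGL 2 L), ∀ q, (QuotientGroup.mk (rep q) : _ ⧸ KG') = q :=
    ⟨Quotient.out, fun q => QuotientGroup.out_eq' q⟩
  -- `mk k = q ↔ rep(q)⁻¹ k ∈ KG'`
  have hmemq : ∀ (q : ↥(standardMaximalCompactGL 2 L) ⧸ KG') (k : ↥(standardMaximalCompactGL 2 L)), (QuotientGroup.mk k : _ ⧸ KG') = q ↔ (rep q)⁻¹ * k ∈ KG' := by
    intro q k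
    have h := QuotientGroup.eq (s := KG') (a := rep q) (b := k)
    rw [hrep q] at h
    exact eq_comm.trans h
  -- each coset is clopen (`KG'` is open, hence closed)
  have hclopen : ∀ q : ↥(standardMaximalCompactGL 2 L) ⧸ KG', IsClopen {k : ↥(standardMaximalCompactGL 2 L) | (QuotientGroup.mk k : _ ⧸ KG') = q} := by
    intro q
    have hset : {k : ↥(standardMaximalCompactGL 2 L) | (QuotientGroup.mk k : _ ⧸ KG') = q} = (fun k => (rep q)⁻¹ * k) ⁻¹' (KG' : Set ↥(standardMaximalCompactGL 2 L)) :=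
      Set.ext fun k => hmemq q k
    rw [hset]
    exact ⟨(Subgroup.isClosed_of_isOpen KG' hKGo).preimage (continuous_const.mul continuous_id), hKGo.preimage (continuous_const.mul continuous_id)⟩
  -- §0' the finite `K_H`-types of the translates (by value), and right translation
  choose ι hι c M G hlaw hexp hG hcc hCc hCM hclev using hKH
  obtain ⟨R, hRB⟩ : ∃ R : ↥(standardMaximalCompactGL 2 L) → (↥(standardMaximalCompactGL 2 L) → ℂ) →ₗ[ℂ] (↥(standardMaximalCompactGL 2 L) → ℂ),
      ∀ k₀ B k, R k₀ B k = B (k * k₀) := ⟨fun k₀ => LinearMap.funLeft ℂ ℂ (fun k : ↥(standardMaximalCompactGL 2 L) => k * k₀), fun _ _ _ => rfl⟩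
  have hRfun : ∀ k₀ B, R k₀ B = fun k => B (k * k₀) := fun k₀ B => funext (hRB k₀ B)
  have hRmul : ∀ (k₁ k₂ : ↥(standardMaximalCompactGL 2 L)) (B : ↥(standardMaximalCompactGL 2 L) → ℂ), R k₁ (R k₂ B) = R (k₁ * k₂) B := fun k₁ k₂ B => by
    funext k; rw [hRB, hRB, hRB, mul_assoc]
  -- §1 the generators `g_{q,l}(k) = 𝟙[mk k = q] · a k · c^{(q)}_l(Λ(rep q⁻¹ k))` and their span `W₀`
  obtain ⟨gen, hgen⟩ : ∃ gen : (Σ q : ↥(standardMaximalCompactGL 2 L) ⧸ KG', ι (rep q)) → (↥(standardMaximalCompactGL 2 L) → ℂ),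
      ∀ p k, gen p k = if (QuotientGroup.mk k : _ ⧸ KG') = p.1 then
        a k * c (rep p.1) p.2 (Λ (((rep p.1)⁻¹ * k : ↥(standardMaximalCompactGL 2 L)) : GL (Fin 2) (AdeleRing (𝓞 L) L))) else 0 := ⟨_, fun _ _ => rfl⟩
  set W₀ : Submodule ℂ (↥(standardMaximalCompactGL 2 L) → ℂ) := Submodule.span ℂ (Set.range gen) with hW₀
  haveI hfd₀ : FiniteDimensional ℂ W₀ := FiniteDimensional.span_of_finite ℂ (Set.finite_range gen)
  -- the image `Λ(rep q⁻¹ k)` lies in `K_H` on the coset `q`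
  have hΛKH : ∀ (q : ↥(standardMaximalCompactGL 2 L) ⧸ KG') (k : ↥(standardMaximalCompactGL 2 L)), (QuotientGroup.mk k : _ ⧸ KG') = q →
      Λ (((rep q)⁻¹ * k : ↥(standardMaximalCompactGL 2 L)) : GL (Fin 2) (AdeleRing (𝓞 L) L)) ∈ KH := fun q k hk =>
    hΛK _ ((hmemKG' _).1 ((hmemq q k).1 hk))
  -- (1a) the generators are continuous
  have hgen_cont : ∀ p, Continuous (gen p) := by
    rintro ⟨q, l⟩
    have hfun : gen ⟨q, l⟩ = fun k => if (QuotientGroup.mk k : _ ⧸ KG') = q then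
        a k * c (rep q) l (Λ (((rep q)⁻¹ * k : ↥(standardMaximalCompactGL 2 L)) : GL (Fin 2) (AdeleRing (𝓞 L) L))) else 0 := funext fun k => hgen ⟨q, l⟩ k
    rw [hfun]
    refine Continuous.if (fun k hk => ?_) ?_ continuous_const
    · rw [(hclopen q).frontier_eq] at hk
      exact absurd hk (Set.notMem_empty k)
    · exact ha_cont.mul ((hcc (rep q) l).comp (hΛc.comp (continuous_subtype_val.comp (continuous_const.mul continuous_id))))
  -- (1b) right translation by `t ∈ KG'` of a generator
  have hgen_KG : ∀ (q : ↥(standardMaximalCompactGL 2 L) ⧸ KG') (l : ι (rep q)) (t : ↥(standardMaximalCompactGL 2 L)), t ∈ KG' →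
      R t (gen ⟨q, l⟩) = ∑ m, (a t * M (rep q) l m (Λ t)) • gen ⟨q, m⟩ := by
    intro q l t ht
    have htKH : Λ (t : GL (Fin 2) (AdeleRing (𝓞 L) L)) ∈ KH := hΛK _ ((hmemKG' t).1 ht)
    funext k
    rw [hRB, Finset.sum_apply, hgen]
    simp only [Pi.smul_apply, smul_eq_mul, hgen]
    rw [QuotientGroup.mk_mul_of_mem k ht]
    by_cases hk : (QuotientGroup.mk k : _ ⧸ KG') = q
    · simp only [hk, if_true]
      have hmul : (((rep q)⁻¹ * (k * t) : ↥(standardMaximalCompactGL 2 L)) : GL (Fin 2) (AdeleRing (𝓞 L) L)) =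
          (((rep q)⁻¹ * k : ↥(standardMaximalCompactGL 2 L)) : GL (Fin 2) (AdeleRing (𝓞 L) L)) * (t : GL (Fin 2) (AdeleRing (𝓞 L) L)) := by
        rw [← mul_assoc, Subgroup.coe_mul]
      rw [hmul, map_mul, hlaw (rep q) l _ _ htKH, ha_mul, Finset.mul_sum]
      exact Finset.sum_congr rfl fun m _ => by ring
    · simp only [hk, if_false, mul_zero, Finset.sum_const_zero]
  -- (1c) `W₀` is right-`KG'`-stable
  have hstab₀ : ∀ B ∈ W₀, ∀ t : ↥(standardMaximalCompactGL 2 L), t ∈ KG' → R t B ∈ W₀ := by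
    intro B hB t ht
    have hmap : W₀.map (R t) ≤ W₀ := by
      rw [hW₀, Submodule.map_span_le]
      rintro _ ⟨⟨q, l⟩, rfl⟩
      rw [hgen_KG q l t ht]
      exact Submodule.sum_mem _ fun m _ => Submodule.smul_mem _ _ (Submodule.subset_span ⟨⟨q, m⟩, rfl⟩)
    exact hmap (Submodule.mem_map_of_mem hB)
  -- §2 `W₁ := ⨆_q R_{rep q} W₀`: finite-dimensional, right-`K`-stable, contains `W₀`
  set W₁ : Submodule ℂ (↥(standardMaximalCompactGL 2 L) → ℂ) := ⨆ q : ↥(standardMaximalCompactGL 2 L) ⧸ KG', W₀.map (R (rep q)) with hW₁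
  haveI hfd₁ : FiniteDimensional ℂ W₁ := Submodule.finiteDimensional_iSup _
  have hRW : ∀ (k' : ↥(standardMaximalCompactGL 2 L)), ∀ B ∈ W₀, R k' B ∈ W₁ := by
    intro k' B hB
    set q' : ↥(standardMaximalCompactGL 2 L) ⧸ KG' := QuotientGroup.mk k' with hq'
    have ht : (rep q')⁻¹ * k' ∈ KG' := (hmemq q' k').1 rfl
    have hk' : k' = rep q' * ((rep q')⁻¹ * k') := (mul_inv_cancel_left _ _).symm
    rw [hk', ← hRmul]
    exact Submodule.mem_iSup_of_mem q' (Submodule.mem_map_of_mem (hstab₀ B hB _ ht))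
  have hW₀W₁ : W₀ ≤ W₁ := fun B hB => by
    have h := hRW 1 B hB
    have h1 : R 1 B = B := funext fun k => by rw [hRB, mul_one]
    rwa [h1] at h
  have hstab₁ : ∀ B ∈ W₁, ∀ k₀ : ↥(standardMaximalCompactGL 2 L), R k₀ B ∈ W₁ := by
    intro B hB k₀
    refine Submodule.iSup_induction (motive := fun B => R k₀ B ∈ W₁) _ hB (fun q B hBq => ?_) ?_ (fun B₁ B₂ h₁ h₂ => ?_)
    · obtain ⟨B', hB', rfl⟩ := Submodule.mem_map.1 hBq
      rw [hRmul]
      exact hRW _ B' hB'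
    · rw [map_zero]; exact Submodule.zero_mem _
    · rw [map_add]; exact Submodule.add_mem _ h₁ h₂
  -- §3 the `B ∩ K`-law subspace and `W := W₁ ⊓ Wlaw`
  set Wlaw : Submodule ℂ (↥(standardMaximalCompactGL 2 L) → ℂ) := ⨅ (p : ↥(standardMaximalCompactGL 2 L)) (k : ↥(standardMaximalCompactGL 2 L)) (_ : ((p : GL (Fin 2) (AdeleRing (𝓞 L) L)) : Matrix (Fin 2) (Fin 2) (AdeleRing (𝓞 L) L)) 1 0 = 0),
    LinearMap.ker ((LinearMap.proj (p * k) : (↥(standardMaximalCompactGL 2 L) → ℂ) →ₗ[ℂ] ℂ) - LinearMap.proj k) with hWlaw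
  have hmemlaw : ∀ B : ↥(standardMaximalCompactGL 2 L) → ℂ, B ∈ Wlaw ↔ ∀ p k : ↥(standardMaximalCompactGL 2 L), ((p : GL (Fin 2) (AdeleRing (𝓞 L) L)) : Matrix (Fin 2) (Fin 2) (AdeleRing (𝓞 L) L)) 1 0 = 0 → B (p * k) = B k := by
    intro B
    simp only [hWlaw, Submodule.mem_iInf, LinearMap.mem_ker, LinearMap.sub_apply, LinearMap.coe_proj, Function.eval, sub_eq_zero]
  -- §4 every `φ(s, x)|_K` lies in `W₀` and has the `B ∩ K`-law
  have hφ₀ : ∀ (s : ℂ) (x : X), 0 < s.re → (fun k : ↥(standardMaximalCompactGL 2 L) => φ s x k) ∈ W₀ := by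
    intro s x hs
    have hEq : (fun k : ↥(standardMaximalCompactGL 2 L) => φ s x k) =
        ∑ q : ↥(standardMaximalCompactGL 2 L) ⧸ KG', ∑ j : ι (rep q), ∑ l : ι (rep q), (b x * G (rep q) j s * M (rep q) j l (kx x)) • gen ⟨q, l⟩ := by
      funext k
      have hmem := hΛKH (QuotientGroup.mk k) k rfl
      -- the left-hand side on the coset of `k`
      have hk : Λ (k : GL (Fin 2) (AdeleRing (𝓞 L) L)) =
          Λ ((rep (QuotientGroup.mk k : _ ⧸ KG') : ↥(standardMaximalCompactGL 2 L)) : GL (Fin 2) (AdeleRing (𝓞 L) L)) *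
          Λ (((rep (QuotientGroup.mk k : _ ⧸ KG'))⁻¹ * k : ↥(standardMaximalCompactGL 2 L)) : GL (Fin 2) (AdeleRing (𝓞 L) L)) := by
        rw [← map_mul, ← Subgroup.coe_mul, mul_inv_cancel_left]
      have hL : φ s x k = ∑ j : ι (rep (QuotientGroup.mk k : _ ⧸ KG')), ∑ l : ι (rep (QuotientGroup.mk k : _ ⧸ KG')),
          (b x * G (rep (QuotientGroup.mk k)) j s * M (rep (QuotientGroup.mk k)) j l (kx x)) * gen ⟨QuotientGroup.mk k, l⟩ k := by
        rw [hφ, hk, mul_assoc (Λ _), hexp (rep (QuotientGroup.mk k)) s hs _ (KH.mul_mem hmem (hkx x)), Finset.mul_sum]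
        refine Finset.sum_congr rfl fun j _ => ?_
        rw [hlaw (rep (QuotientGroup.mk k)) j _ _ (hkx x), Finset.sum_mul, Finset.mul_sum]
        refine Finset.sum_congr rfl fun l _ => ?_
        rw [hgen, if_pos rfl]
        ring
      -- the right-hand side: only the coset of `k` contributes
      rw [hL, Finset.sum_apply, Finset.sum_eq_single (QuotientGroup.mk k : _ ⧸ KG')]
      · simp only [Finset.sum_apply, Pi.smul_apply, smul_eq_mul]
      · intro q _ hq
        have hne : ¬ (QuotientGroup.mk k : _ ⧸ KG') = q := fun h => hq h.symm
        simp only [Finset.sum_apply, Pi.smul_apply, smul_eq_mul, hgen, if_neg hne, mul_zero, Finset.sum_const_zero]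
      · intro h; exact absurd (Finset.mem_univ _) h
    rw [hEq]
    exact Submodule.sum_mem _ fun q _ => Submodule.sum_mem _ fun j _ => Submodule.sum_mem _ fun l _ =>
      Submodule.smul_mem _ _ (Submodule.subset_span ⟨⟨q, l⟩, rfl⟩)
  have hφlaw : ∀ (s : ℂ) (x : X), 0 < s.re → (fun k : ↥(standardMaximalCompactGL 2 L) => φ s x k) ∈ Wlaw := by
    intro s x hs
    rw [hmemlaw]
    intro p k hp
    exact borel_compact_law_of_flat (φ s x) (s + 1 / 2) (-(s + 1 / 2)) (hφT s x hs) (hφN s x hs) p k hp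
  -- §5 continuity of the members of `W₁`
  have hcont₀ : ∀ B ∈ W₀, Continuous B := by
    intro B hB
    induction hB using Submodule.span_induction with
    | mem x hx =>
      obtain ⟨p, rfl⟩ := hx
      exact hgen_cont p
    | zero => exact continuous_const
    | add x y _ _ hx hy => exact hx.add hy
    | smul r x _ hx => exact continuous_const.mul hx
  have hcont₁ : ∀ B ∈ W₁, Continuous B := by
    intro B hB
    refine Submodule.iSup_induction (motive := fun B => Continuous B) _ hB (fun q B hBq => ?_) continuous_const (fun B₁ B₂ h₁ h₂ => h₁.add h₂)
    obtain ⟨B', hB', rfl⟩ := Submodule.mem_map.1 hBq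
    rw [hRfun]
    exact (hcont₀ B' hB').comp (continuous_id.mul continuous_const)
  -- §6 the level: `R_{r̂} B = B` on `W₀` (`r̂ ∈ KG`, `a`-invariance, `U`-level of `c`), then on `W₁` (`hlevN`)
  have hlev₀ : ∀ B ∈ W₀, ∀ (r : GL (Fin 2) (FiniteAdeleRing (𝓞 L) L)) (hr : r ∈ glFiniteIntegralLevel 2 L),
      (∀ v ∈ S, GLn.evalAt 2 L v r ∈ congruenceGL 2 (γl v)) →
      ∀ k : ↥(standardMaximalCompactGL 2 L), B (k * ⟨GLn.ofFinite 2 L r, ofFinite_mem hr⟩) = B k := by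
    intro B hB r hr hrS
    have hrKG : (⟨GLn.ofFinite 2 L r, ofFinite_mem hr⟩ : ↥(standardMaximalCompactGL 2 L)) ∈ KG' := (hmemKG' _).2 (hlevKG r hr hrS)
    induction hB using Submodule.span_induction with
    | mem x hx =>
      obtain ⟨⟨q, l⟩, rfl⟩ := hx
      intro k
      rw [hgen, hgen, QuotientGroup.mk_mul_of_mem k hrKG]
      by_cases hk : (QuotientGroup.mk k : _ ⧸ KG') = q
      · simp only [hk, if_true]
        have hmul : (((rep q)⁻¹ * (k * ⟨GLn.ofFinite 2 L r, ofFinite_mem hr⟩) : ↥(standardMaximalCompactGL 2 L)) : GL (Fin 2) (AdeleRing (𝓞 L) L)) =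
            (((rep q)⁻¹ * k : ↥(standardMaximalCompactGL 2 L)) : GL (Fin 2) (AdeleRing (𝓞 L) L)) * GLn.ofFinite 2 L r := by
          rw [← mul_assoc, Subgroup.coe_mul]
        rw [hmul, map_mul, hclev (rep q) l _ _ (hΛU r hr hrS)]
        have ha : a ((k * ⟨GLn.ofFinite 2 L r, ofFinite_mem hr⟩ : ↥(standardMaximalCompactGL 2 L)) : GL (Fin 2) (AdeleRing (𝓞 L) L)) = a k := by
          rw [Subgroup.coe_mul]
          exact ha_lev k r hr hrS
        rw [ha]
      · simp only [hk, if_false]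
    | zero => intro k; rfl
    | add x y _ _ hx hy => intro k; rw [Pi.add_apply, Pi.add_apply, hx, hy]
    | smul t x _ hx => intro k; rw [Pi.smul_apply, Pi.smul_apply, hx]
  have hlev₁ : ∀ B ∈ W₁, ∀ (r : GL (Fin 2) (FiniteAdeleRing (𝓞 L) L)) (hr : r ∈ glFiniteIntegralLevel 2 L),
      (∀ v ∈ S, GLn.evalAt 2 L v r ∈ congruenceGL 2 (γl v)) →
      ∀ k : ↥(standardMaximalCompactGL 2 L), B (k * ⟨GLn.ofFinite 2 L r, ofFinite_mem hr⟩) = B k := by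
    intro B hB r hr hrS
    refine Submodule.iSup_induction (motive := fun B => ∀ k : ↥(standardMaximalCompactGL 2 L), B (k * ⟨GLn.ofFinite 2 L r, ofFinite_mem hr⟩) = B k) _ hB
      (fun q B hBq => ?_) (fun k => rfl) (fun B₁ B₂ h₁ h₂ k => by rw [Pi.add_apply, Pi.add_apply, h₁, h₂])
    obtain ⟨B', hB', rfl⟩ := Submodule.mem_map.1 hBq
    intro k
    obtain ⟨r', hr', hr'S, hconj⟩ := hlevN r hr hrS (rep q)
    -- `r̂ · rep q = rep q · r̂′` in `K`
    have hcomm : (⟨GLn.ofFinite 2 L r, ofFinite_mem hr⟩ : ↥(standardMaximalCompactGL 2 L)) * rep q =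
        rep q * ⟨GLn.ofFinite 2 L r', ofFinite_mem hr'⟩ := by
      refine Subtype.ext ?_
      show GLn.ofFinite 2 L r * ((rep q : ↥(standardMaximalCompactGL 2 L)) : GL (Fin 2) (AdeleRing (𝓞 L) L)) =
        ((rep q : ↥(standardMaximalCompactGL 2 L)) : GL (Fin 2) (AdeleRing (𝓞 L) L)) * GLn.ofFinite 2 L r'
      rw [← hconj, ← mul_assoc, ← mul_assoc, mul_inv_cancel, one_mul]
    rw [hRB, hRB, mul_assoc, hcomm, ← mul_assoc]
    exact hlev₀ B' hB' r' hr' hr'S (k * rep q)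
  -- §7 the package
  refine ⟨W₁ ⊓ Wlaw, Submodule.finiteDimensional_of_le inf_le_left, ?_, ?_, ?_, ?_, ?_, ?_, ?_⟩
  · -- hWstab
    intro B hB k₀
    refine Submodule.mem_inf.2 ⟨?_, (hmemlaw _).2 fun p k hp => ?_⟩
    · have h := hstab₁ B (Submodule.mem_inf.1 hB).1 k₀
      rwa [hRfun] at h
    · show B (p * k * k₀) = B (k * k₀)
      rw [mul_assoc]
      exact (hmemlaw B).1 (Submodule.mem_inf.1 hB).2 p (k * k₀) hp
  · -- hWlaw
    intro B hB p k hp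
    exact (hmemlaw B).1 (Submodule.mem_inf.1 hB).2 p k hp
  · -- hWlev
    intro B hB k r hr hrS
    exact hlev₁ B (Submodule.mem_inf.1 hB).1 r hr hrS k
  · -- hWcont
    intro B hB
    exact hcont₁ B (Submodule.mem_inf.1 hB).1
  · -- hWext (★ (β0-ext))
    intro B hB
    exact exists_flat_extension B ((hmemlaw B).1 (Submodule.mem_inf.1 hB).2)
  · -- hφW
    intro s x hs
    exact Submodule.mem_inf.2 ⟨hW₀W₁ (hφ₀ s x hs), hφlaw s x hs⟩
  · -- hφbd: on the half-ball `dist s z < re z ∕ 2`, uniformly over the finitely many cosets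
    intro z hz
    obtain ⟨Cc, hCc⟩ : ∃ Cc : (↥(standardMaximalCompactGL 2 L) ⧸ KG') → ℝ, ∀ q j, ∀ h ∈ KH, ‖c (rep q) j h‖ ≤ Cc q :=
      ⟨fun q => (hCc (rep q)).choose, fun q => (hCc (rep q)).choose_spec⟩
    have hCGex : ∀ (q : ↥(standardMaximalCompactGL 2 L) ⧸ KG') (j : ι (rep q)), ∃ C : ℝ, 0 ≤ C ∧ ∀ s : ℂ, dist s z ≤ z.re / 2 → ‖G (rep q) j s‖ ≤ C :=
      fun q j => exists_bound_of_continuousOn_halfBall (hG (rep q) j) hz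
    choose CG hCG0 hCG using hCGex
    have hCa0 : 0 ≤ Ca := (norm_nonneg _).trans (hCa 1)
    -- `‖F s (Λ k · k_x)‖ ≤ CF` on the half-ball
    set CF : ℝ := ∑ q : ↥(standardMaximalCompactGL 2 L) ⧸ KG', ∑ j : ι (rep q), max (Cc q) 0 * CG q j with hCF
    have hCFq0 : ∀ q : ↥(standardMaximalCompactGL 2 L) ⧸ KG', 0 ≤ ∑ j : ι (rep q), max (Cc q) 0 * CG q j := fun q =>
      Finset.sum_nonneg fun j _ => mul_nonneg (le_max_right _ _) (hCG0 q j)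
    have hCF0 : 0 ≤ CF := Finset.sum_nonneg fun q _ => hCFq0 q
    refine ⟨Ca * CF * max C₀ 0, A₀, z.re / 2, mul_nonneg (mul_nonneg hCa0 hCF0) (le_max_right _ _), hA₀, half_pos hz, fun s hs x k => ?_⟩
    have hs' : dist s z ≤ z.re / 2 := hs.le
    have hsre : 0 < s.re := lt_of_lt_of_le (half_pos hz) (re_half_lt_re_of_dist_le hs')
    set q₀ : ↥(standardMaximalCompactGL 2 L) ⧸ KG' := QuotientGroup.mk k with hq₀
    have hmem := hΛKH q₀ k rfl
    have hk : Λ (k : GL (Fin 2) (AdeleRing (𝓞 L) L)) = Λ ((rep q₀ : ↥(standardMaximalCompactGL 2 L)) : GL (Fin 2) (AdeleRing (𝓞 L) L)) *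
        Λ (((rep q₀)⁻¹ * k : ↥(standardMaximalCompactGL 2 L)) : GL (Fin 2) (AdeleRing (𝓞 L) L)) := by
      rw [← map_mul, ← Subgroup.coe_mul, mul_inv_cancel_left]
    have hFb : ‖F s (Λ k * kx x)‖ ≤ CF := by
      rw [hk, mul_assoc (Λ _), hexp (rep q₀) s hsre _ (KH.mul_mem hmem (hkx x))]
      refine (norm_sum_le _ _).trans ((Finset.sum_le_sum fun j _ => ?_).trans (Finset.single_le_sum (fun q _ => hCFq0 q) (Finset.mem_univ q₀)))
      rw [norm_mul]
      exact mul_le_mul ((hCc q₀ j _ (KH.mul_mem hmem (hkx x))).trans (le_max_left _ _)) (hCG q₀ j s hs') (norm_nonneg _) (le_max_right _ _)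
    have hbx : ‖b x‖ ≤ max C₀ 0 * height x ^ A₀ :=
      (hb x).trans (mul_le_mul_of_nonneg_right (le_max_left _ _) (Real.rpow_nonneg (hpos x).le _))
    rw [hφ, norm_mul, norm_mul]
    calc ‖a k‖ * ‖b x‖ * ‖F s (Λ k * kx x)‖ ≤ Ca * (max C₀ 0 * height x ^ A₀) * CF :=
          mul_le_mul (mul_le_mul (hCa k) hbx (norm_nonneg _) hCa0) hFb (norm_nonneg _)
            (mul_nonneg hCa0 (mul_nonneg (le_max_right _ _) (Real.rpow_nonneg (hpos x).le _)))
      _ = Ca * CF * max C₀ 0 * height x ^ A₀ := by ring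

end Summit.HodgeConjecture.HodgeConjecture.Cruxes.HLiu418.K2LiuSiegelMiddleTermKTypesLevel

end
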